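import Summits.BirchSwinnertonDyer.BirchSwinnertonDyer.Theorems.ThetaPartnerAtTwoMazurTateCongruenceAtTwoRTraceParity
import Summits.BirchSwinnertonDyer.BirchSwinnertonDyer.Theorems.AlignedTransportAtTwoMainConjectureTransportAlignedAtTwoBridge
import Literature.NumberTheory.EllipticCurves.TwoAdicImageSurjectivityModTwoProofs
import Literature.NumberTheory.EllipticCurves.HidaFamilyMembersProofs
import Mathlib.FieldTheory.PrimitiveElement
import HarnessLib

/-!
# Crux C1 `MainConjectureTransportAlignedAtTwo` (stmt-BirchSwinnertonDyer-22296), line `birth`: a SHARED CUBIC FIELD gives a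
# Galois-equivariant `W₁[2] ≃ W₂[2]`, hence `a_q(W₁) ≡ a_q(W₂) (mod 2)` (lead att-p1 g9; `--supports 22296`)

THEOREMS ONLY (no `def`, no named fact, no `sorry`). BSD is not proved by this; C1 is not closed by this.

The crux binds its two curves through a cubic number field `F` (`finrank ℚ F = 3`) and roots `e₁, e₂ ∈ F` of the two `u`-cubics
`twoDivisionUCubic Wᵢ = u³ + b₂u² + 8b₄u + 16b₆` (`u = 4x` over the `2`-division polynomial), both curves without rational
`2`-torsion abscissa. This file proves what every analytic use of the congruence needs and the tree did not have:

* §1 (on top of the g0 bridge `…Bridge`: the `u`-cubic is monic, irreducible under the crux binder, `= minpoly`) `F = ℚ(eᵢ)` and the three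
  embeddings `σ : F → ℚ̄` are told apart by `σ eᵢ`;
* §2 `σ eᵢ / 4` is the abscissa of a non-zero `2`-torsion point of `Wᵢ` over `ℚ̄` (`DokchitserDokchitser2012.xT`), giving a bijection
  `(F →ₐ[ℚ] ℚ̄) ≃ {T₀, T₁, T₂}` for each curve, compatible with `Γ_ℚ` (`σ ↦ g ∘ σ` versus `permGal g`);
* §3 **`exists_equivariant_addEquiv_of_sharedCubicField`**: a `Γ_ℚ`-equivariant additive isomorphism `W₁[2] ≃+ W₂[2]`
  (`T_{j₁(σ)} ↦ T_{j₂(σ)}`; every bijection of the non-zero vectors of `(ℤ/2)²` is additive);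
* §4 **`even_frobeniusTrace_sub_of_sharedCubicField`**: `a_q(W₁) ≡ a_q(W₂) (mod 2)` at every odd prime `q ∤ N₁N₂` (both curves
  globally minimal), by cell bsd-wall's `MazurTateCongruenceAtTwoR.even_frobeniusTrace_sub_of_equiv`; and the `LFunction`-coefficient
  form `even_LFunction_sub_of_sharedCubicField` used by the plus-line consumer.

References: Silverman AEC III.§1–§2, III.6.4, III.§7 [SilvermanAEC2009]; Darmon–Diamond–Taylor Prop. 2.11 (a) [DarmonDiamondTaylor1995];
Dokchitser–Dokchitser Math. Z. 272 (2012) [DokchitserDokchitserMathZ2012] (the `{T₀,T₁,T₂}` bookkeeping of the tree).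
-/

noncomputable section

-- justification: the `Summit.BirchSwinnertonDyer.BirchSwinnertonDyer.…` path repeats a component (route-file convention)
set_option linter.dupNamespace false

open scoped Classical NumberField IntermediateField
open Polynomial WeierstrassCurve Module
open Literature.NumberTheory.EllipticCurves Literature.NumberTheory.EllipticCurves.Greenberg1999
open Literature.NumberTheory.EllipticCurves.DokchitserDokchitser2012
open Summit.BirchSwinnertonDyer.Rank1Residual.F1Sign2
open Summit.BirchSwinnertonDyer.BirchSwinnertonDyer.Theorems.AlignedTransportAtTwoBridge

namespace Summit.BirchSwinnertonDyer.BirchSwinnertonDyer.Theorems.AlignedTransportAtTwoSharedCubicTorsion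

/-! ## §1 The root of the `u`-cubic generates the cubic field -/

section UCubic

variable (W : WeierstrassCurve ℚ)

/-- Evaluation of the `u`-cubic in any `ℚ`-algebra. [folklore] -/
theorem aeval_twoDivisionUCubic {A : Type*} [CommRing A] [Algebra ℚ A] (u : A) :
    aeval u (twoDivisionUCubic W) =
      u ^ 3 + algebraMap ℚ A W.b₂ * u ^ 2 + algebraMap ℚ A (8 * W.b₄) * u + algebraMap ℚ A (16 * W.b₆) := by
  simp only [twoDivisionUCubic, map_add, map_mul, map_pow, aeval_X, aeval_C]

variable {F : Type*} [Field F] [Algebra ℚ F]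

/-- **A root of the `u`-cubic generates the cubic field**: `ℚ⟮e⟯ = F` when `[F : ℚ] = 3` (the `u`-cubic is `minpoly_ℚ e` by the g0 bridge
`minpoly_eq_twoDivisionUCubic`). [folklore] -/
theorem adjoin_root_eq_top [FiniteDimensional ℚ F] (hF : finrank ℚ F = 3) (ht : ∀ x : ℚ, ¬ HasRationalTwoTorsionX W x)
    {e : F} (he : aeval e (twoDivisionUCubic W) = 0) : ℚ⟮e⟯ = ⊤ := by
  rw [Field.primitive_element_iff_minpoly_natDegree_eq, minpoly_eq_twoDivisionUCubic W ht he, natDegree_twoDivisionUCubic, hF]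

/-- **The embeddings `F → ℚ̄` are told apart by the image of the root `e`.** [folklore] -/
theorem injective_eval_root [FiniteDimensional ℚ F] (hF : finrank ℚ F = 3) (ht : ∀ x : ℚ, ¬ HasRationalTwoTorsionX W x)
    {e : F} (he : aeval e (twoDivisionUCubic W) = 0) :
    Function.Injective fun φ : F →ₐ[ℚ] AlgebraicClosure ℚ ↦ φ e :=
  (Field.primitive_element_iff_algHom_eq_of_eval' ℚ (AlgebraicClosure ℚ) (fun _ ↦ IsAlgClosed.splits _) e).mp
    (adjoin_root_eq_top W hF ht he)

end UCubic

/-! ## §2 Embeddings of `F` versus the three non-zero `2`-torsion points over `ℚ̄` -/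

section Points

variable (W : WeierstrassCurve ℚ) [W.IsElliptic] {F : Type*} [Field F] [Algebra ℚ F]

/-- **`σ e / 4` is the abscissa of a non-zero `2`-torsion point of `W` over `ℚ̄`**: it is a root of the `2`-division cubic
`4x³ + b₂x² + 2b₄x + b₆` (`= (u³ + b₂u² + 8b₄u + 16b₆)/16` at `u = 4x`), whose roots are `x(T₀), x(T₁), x(T₂)`
(`DokchitserDokchitser2012.roots_twoTorsionPolynomial`). [cite: SilvermanAEC2009, Ex. III.3.7 (d)] -/
theorem exists_xT_eq {e : F} (he : aeval e (twoDivisionUCubic W) = 0) (σ : F →ₐ[ℚ] AlgebraicClosure ℚ) :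
    ∃ j : Fin 3, xT W two_ne_zero j = σ e / 4 := by
  set x : AlgebraicClosure ℚ := σ e / 4 with hx
  have hu : aeval (σ e) (twoDivisionUCubic W) = 0 := by rw [aeval_algHom_apply, he, map_zero]
  rw [aeval_twoDivisionUCubic] at hu
  have hroot : (Cubic.map (algebraMap ℚ (AlgebraicClosure ℚ)) W.twoTorsionPolynomial).toPoly.IsRoot x := by
    rw [Cubic.map_toPoly, IsRoot.def, eval_map, ← aeval_def]
    simp only [WeierstrassCurve.twoTorsionPolynomial, Cubic.toPoly, map_add, map_mul, map_pow, aeval_X, aeval_C]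
    have h4 : σ e = 4 * x := by rw [hx]; ring
    rw [h4] at hu
    simp only [map_mul, map_ofNat] at hu ⊢
    linear_combination (1 / 16 : AlgebraicClosure ℚ) * hu
  have hne : (Cubic.map (algebraMap ℚ (AlgebraicClosure ℚ)) W.twoTorsionPolynomial).toPoly ≠ 0 := by
    refine Cubic.ne_zero_of_a_ne_zero ?_
    change algebraMap ℚ (AlgebraicClosure ℚ) 4 ≠ 0
    rw [map_ofNat]; norm_num
  have hmem₀ : x ∈ Cubic.roots (Cubic.map (algebraMap ℚ (AlgebraicClosure ℚ)) W.twoTorsionPolynomial) :=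
    (mem_roots hne).mpr hroot
  have hmem : x ∈ ({xT W two_ne_zero 0, xT W two_ne_zero 1, xT W two_ne_zero 2} : Multiset (AlgebraicClosure ℚ)) := by
    rw [← roots_twoTorsionPolynomial W two_ne_zero]
    exact hmem₀
  simp only [Multiset.insert_eq_cons, Multiset.mem_cons, Multiset.mem_singleton] at hmem
  rcases hmem with h | h | h
  · exact ⟨0, h.symm⟩
  · exact ⟨1, h.symm⟩
  · exact ⟨2, h.symm⟩

/-- **The index map**: there is `j : (F →ₐ[ℚ] ℚ̄) → {0,1,2}` with `x(T_{j(σ)}) = σ e / 4` for every embedding `σ`. [folklore] -/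
theorem exists_index_fun {e : F} (he : aeval e (twoDivisionUCubic W) = 0) :
    ∃ j : (F →ₐ[ℚ] AlgebraicClosure ℚ) → Fin 3, ∀ σ, xT W two_ne_zero (j σ) = σ e / 4 :=
  ⟨fun σ ↦ (exists_xT_eq W he σ).choose, fun σ ↦ (exists_xT_eq W he σ).choose_spec⟩

/-- **Any index map `σ ↦ j(σ)` is a bijection `(F →ₐ[ℚ] ℚ̄) ≃ {0,1,2}`** when `[F : ℚ] = 3` and the `u`-cubic has no rational root:
injective because `σ e` determines `σ` (§1), and both sides have three elements (`AlgHom.card`). [cite: SilvermanAEC2009, III.§7] -/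
theorem bijective_index [FiniteDimensional ℚ F] (hF : finrank ℚ F = 3) (ht : ∀ x : ℚ, ¬ HasRationalTwoTorsionX W x)
    {e : F} (he : aeval e (twoDivisionUCubic W) = 0) {j : (F →ₐ[ℚ] AlgebraicClosure ℚ) → Fin 3}
    (hj : ∀ σ, xT W two_ne_zero (j σ) = σ e / 4) : Function.Bijective j := by
  haveI : Algebra.IsSeparable ℚ F := Algebra.IsSeparable.of_integral ℚ F
  have hinj : Function.Injective j := by
    intro σ τ hστ
    apply injective_eval_root W hF ht he
    have h := congrArg (xT W two_ne_zero) hστ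
    rw [hj, hj] at h
    exact (div_left_inj' (by norm_num : (4 : AlgebraicClosure ℚ) ≠ 0)).mp h
  refine (Fintype.bijective_iff_injective_and_card _).mpr ⟨hinj, ?_⟩
  rw [AlgHom.card ℚ F (AlgebraicClosure ℚ), hF, Fintype.card_fin]

/-- **Galois compatibility of an index map**: `permGal g (j(σ)) = j(g ∘ σ)` for `g ∈ Γ_ℚ` (`g·x(T_j) = x(T_{g j})`, `g (σ e) = (g ∘ σ) e`).
[cite: SilvermanAEC2009, III.§7 and VIII.§1] -/
theorem permGal_index {e : F} {j : (F →ₐ[ℚ] AlgebraicClosure ℚ) → Fin 3} (hj : ∀ σ, xT W two_ne_zero (j σ) = σ e / 4)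
    (g : Field.absoluteGaloisGroup ℚ) (σ : F →ₐ[ℚ] AlgebraicClosure ℚ) :
    permGal W two_ne_zero g (j σ) = j ((Field.absoluteGaloisGroup.toAlgEquiv ℚ g).toAlgHom.comp σ) := by
  apply xT_injective W two_ne_zero
  rw [← smul_xT, hj, hj, Field.absoluteGaloisGroup.smul_def, map_div₀, map_ofNat]
  rfl

end Points

/-! ## §3 The equivariant isomorphism `W₁[2] ≃+ W₂[2]` -/

section Iso

/-- Every permutation `π` of the letters `{0,1,2}` induces an ADDITIVE self-map `w ↦ (w = 0 ? 0 : v_{π(idx w)})` of `(ℤ/2)²`: the three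
non-zero vectors are `v₀, v₁, v₀ + v₁`, and a bijection of them preserves «the third is the sum of the other two» (finite check over the six
permutations and sixteen pairs). [folklore] -/
theorem permVec_add : ∀ (π : Equiv.Perm (Fin 3)) (a b : ZMod 2 × ZMod 2),
    (if a + b = 0 then (0 : ZMod 2 × ZMod 2) else vec (π (idx (a + b)))) =
      (if a = 0 then (0 : ZMod 2 × ZMod 2) else vec (π (idx a))) + (if b = 0 then (0 : ZMod 2 × ZMod 2) else vec (π (idx b))) := by
  decide

/-- The map for `π⁻¹` inverts the map for `π`. [folklore] -/
theorem permVec_inv_apply : ∀ (π : Equiv.Perm (Fin 3)) (a : ZMod 2 × ZMod 2),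
    (if (if a = 0 then (0 : ZMod 2 × ZMod 2) else vec (π (idx a))) = 0 then (0 : ZMod 2 × ZMod 2)
      else vec (π⁻¹ (idx (if a = 0 then (0 : ZMod 2 × ZMod 2) else vec (π (idx a)))))) = a := by
  decide

/-- The map for `π` sends `v_i ↦ v_{π i}`. [folklore] -/
theorem permVec_vec : ∀ (π : Equiv.Perm (Fin 3)) (i : Fin 3),
    (if vec i = 0 then (0 : ZMod 2 × ZMod 2) else vec (π (idx (vec i)))) = vec (π i) := by
  decide

variable (W₁ W₂ : WeierstrassCurve ℚ) [W₁.IsElliptic] [W₂.IsElliptic]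

/-- In the frame, `T_i` is `v_i` (unfolding of `DokchitserDokchitser2012.T`). [folklore] -/
theorem frame_T (W : WeierstrassCurve ℚ) [W.IsElliptic] (i : Fin 3) :
    frame W two_ne_zero (T W two_ne_zero i) = vec i := by
  rw [DokchitserDokchitser2012.T, AddEquiv.apply_symm_apply]

/-- **For every permutation `π` of the letters there is an additive isomorphism `W₁[2] ≃+ W₂[2]` with `T_i ↦ T_{π i}`** (through the two
frames `Wᵢ[2] ≅ (ℤ/2)²` and the additive letter-permutation of `(ℤ/2)²`). [cite: SilvermanAEC2009, Cor. III.6.4(b)] -/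
theorem exists_addEquiv_T_eq (π : Equiv.Perm (Fin 3)) :
    ∃ φ : geomTorsion W₁ 2 ≃+ geomTorsion W₂ 2, ∀ i : Fin 3, φ (T W₁ two_ne_zero i) = T W₂ two_ne_zero (π i) := by
  let M : ZMod 2 × ZMod 2 ≃+ ZMod 2 × ZMod 2 :=
    { toFun := fun w ↦ if w = 0 then 0 else vec (π (idx w))
      invFun := fun w ↦ if w = 0 then 0 else vec (π⁻¹ (idx w))
      left_inv := permVec_inv_apply π
      right_inv := fun a ↦ by simpa using permVec_inv_apply π⁻¹ a
      map_add' := permVec_add π }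
  have hM : ∀ i : Fin 3, M (vec i) = vec (π i) := permVec_vec π
  refine ⟨(frame W₁ two_ne_zero).trans (M.trans (frame W₂ two_ne_zero).symm), fun i ↦ ?_⟩
  apply (frame W₂ two_ne_zero).injective
  rw [AddEquiv.trans_apply, AddEquiv.trans_apply, AddEquiv.apply_symm_apply, frame_T, frame_T, hM]

variable {F : Type*} [Field F] [Algebra ℚ F] [FiniteDimensional ℚ F]

/-- **A shared cubic field gives a `Γ_ℚ`-EQUIVARIANT additive isomorphism `W₁[2] ≃+ W₂[2]`.** For elliptic `W₁, W₂ / ℚ` without rational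
`2`-torsion abscissa, a field `F` with `[F : ℚ] = 3` and roots `e₁, e₂ ∈ F` of the two `u`-cubics: the map `T_{j₁(σ)} ↦ T_{j₂(σ)}`
(`σ : F → ℚ̄`; `jᵢ` the bijections of §2) is additive and commutes with `Γ_ℚ` (both index maps intertwine `σ ↦ g ∘ σ` with `permGal g`).
This is the kernel form of «`W₁[2] ≅ W₂[2]` as Galois modules» that the crux's cubic-field binder encodes. [cite: SilvermanAEC2009, III.§7]
[cite: DarmonDiamondTaylor1995, Prop. 2.11 (a) (use)] -/
theorem exists_equivariant_addEquiv_of_sharedCubicField (hF : finrank ℚ F = 3)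
    (ht₁ : ∀ x : ℚ, ¬ HasRationalTwoTorsionX W₁ x) (ht₂ : ∀ x : ℚ, ¬ HasRationalTwoTorsionX W₂ x)
    {e₁ e₂ : F} (he₁ : aeval e₁ (twoDivisionUCubic W₁) = 0) (he₂ : aeval e₂ (twoDivisionUCubic W₂) = 0) :
    ∃ e : geomTorsion W₁ (2 : ℤ) ≃+ geomTorsion W₂ (2 : ℤ),
      ∀ (σ : Field.absoluteGaloisGroup ℚ) (P : geomTorsion W₁ (2 : ℤ)), e (σ • P) = σ • e P := by
  -- the two index maps, bijections `(F →ₐ ℚ̄) ≃ Fin 3`, and the permutation `π = j₂ ∘ j₁⁻¹`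
  obtain ⟨j₁, hj₁⟩ := exists_index_fun W₁ he₁
  obtain ⟨j₂, hj₂⟩ := exists_index_fun W₂ he₂
  set ρ₁ : (F →ₐ[ℚ] AlgebraicClosure ℚ) ≃ Fin 3 := Equiv.ofBijective j₁ (bijective_index W₁ hF ht₁ he₁ hj₁) with hρ₁
  set π : Equiv.Perm (Fin 3) := ρ₁.symm.trans (Equiv.ofBijective j₂ (bijective_index W₂ hF ht₂ he₂ hj₂)) with hπ
  have hπ₁ : ∀ σ, π (j₁ σ) = j₂ σ := fun σ ↦ by
    rw [hπ, Equiv.trans_apply]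
    have : ρ₁.symm (j₁ σ) = σ := by
      apply ρ₁.injective; rw [Equiv.apply_symm_apply]; rfl
    rw [this]; rfl
  -- `π` intertwines the two Galois permutation actions
  have hcomm : ∀ (g : Field.absoluteGaloisGroup ℚ) (i : Fin 3),
      π (permGal W₁ two_ne_zero g i) = permGal W₂ two_ne_zero g (π i) := by
    intro g i
    obtain ⟨σ, rfl⟩ := (bijective_index W₁ hF ht₁ he₁ hj₁).2 i
    rw [permGal_index W₁ hj₁, hπ₁, hπ₁, permGal_index W₂ hj₂]
  obtain ⟨φ, hφ⟩ := exists_addEquiv_T_eq W₁ W₂ π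
  refine ⟨φ, fun g P ↦ ?_⟩
  rcases eq_zero_or_eq_T W₁ two_ne_zero P with rfl | ⟨i, rfl⟩
  · rw [smul_zero, map_zero, smul_zero]
  · rw [← T_permGal, hφ, hφ, hcomm, T_permGal]

end Iso

/-! ## §4 The trace congruence `a_q(W₁) ≡ a_q(W₂) (mod 2)` -/

section Trace

variable (W₁ W₂ : WeierstrassCurve ℚ) [W₁.IsElliptic] [W₁.IsGloballyMinimal] [W₂.IsElliptic] [W₂.IsGloballyMinimal]
  {F : Type*} [Field F] [Algebra ℚ F] [FiniteDimensional ℚ F]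

/-- **`a_q(W₁) ≡ a_q(W₂) (mod 2)` at every odd prime `q ∤ N₁`, `q ∤ N₂` for two globally minimal curves sharing a cubic field**
(§3 + bsd-wall's `MazurTateCongruenceAtTwoR.even_frobeniusTrace_sub_of_equiv`: an even trace makes a local Frobenius an involution on
`W₁[2]`, hence on `W₂[2]`). [cite: DarmonDiamondTaylor1995, Prop. 2.11 (a)] [cite: SilvermanAEC2009, Cor. III.6.4(b)] -/
theorem even_frobeniusTrace_sub_of_sharedCubicField (hF : finrank ℚ F = 3)
    (ht₁ : ∀ x : ℚ, ¬ HasRationalTwoTorsionX W₁ x) (ht₂ : ∀ x : ℚ, ¬ HasRationalTwoTorsionX W₂ x)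
    {e₁ e₂ : F} (he₁ : aeval e₁ (twoDivisionUCubic W₁) = 0) (he₂ : aeval e₂ (twoDivisionUCubic W₂) = 0)
    {q : ℕ} (hq : q.Prime) (hq2 : q ≠ 2) (hq₁ : ¬ q ∣ W₁.conductorNorm ℤ) (hq₂ : ¬ q ∣ W₂.conductorNorm ℤ) :
    Even (W₁.frobeniusTrace q - W₂.frobeniusTrace q) := by
  obtain ⟨e, he⟩ := exists_equivariant_addEquiv_of_sharedCubicField W₁ W₂ hF ht₁ ht₂ he₁ he₂
  exact Summit.BirchSwinnertonDyer.BirchSwinnertonDyer.Theorems.MazurTateCongruenceAtTwoR.even_frobeniusTrace_sub_of_equiv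
    W₁ W₂ e he hq hq2 hq₁ hq₂

/-- **`a_q` congruence in `LFunction`-coefficient currency**: `W₁.LFunction q − W₂.LFunction q` is even at every odd prime `q ∤ N₁N₂`
(at such `q` both curves are good and `LFunction q = a_q`). [cite: DarmonDiamondTaylor1995, Prop. 2.11 (a)] -/
theorem even_LFunction_sub_of_sharedCubicField (hF : finrank ℚ F = 3)
    (ht₁ : ∀ x : ℚ, ¬ HasRationalTwoTorsionX W₁ x) (ht₂ : ∀ x : ℚ, ¬ HasRationalTwoTorsionX W₂ x)
    {e₁ e₂ : F} (he₁ : aeval e₁ (twoDivisionUCubic W₁) = 0) (he₂ : aeval e₂ (twoDivisionUCubic W₂) = 0)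
    {q : ℕ} (hq : q.Prime) (hq2 : q ≠ 2) (hq₁ : ¬ q ∣ W₁.conductorNorm ℤ) (hq₂ : ¬ q ∣ W₂.conductorNorm ℤ) :
    Even (W₁.LFunction q - W₂.LFunction q) := by
  haveI : Fact q.Prime := ⟨hq⟩
  have hg₁ : W₁.HasGoodReductionAtPrime q := hasGoodReductionAtPrime_of_not_dvd_conductorNorm W₁ hq₁
  have hg₂ : W₂.HasGoodReductionAtPrime q := hasGoodReductionAtPrime_of_not_dvd_conductorNorm W₂ hq₂
  rw [LFunction_apply_prime_eq_frobeniusTrace W₁ q hg₁, LFunction_apply_prime_eq_frobeniusTrace W₂ q hg₂]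
  exact even_frobeniusTrace_sub_of_sharedCubicField W₁ W₂ hF ht₁ ht₂ he₁ he₂ hq hq2 hq₁ hq₂

end Trace

end Summit.BirchSwinnertonDyer.BirchSwinnertonDyer.Theorems.AlignedTransportAtTwoSharedCubicTorsion

end
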